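import Summits.ResolutionOfSingularities.ResolutionOfSingularities.Theorems.NonRuledDivisors.Negative.WithoutSingularCentreHolds
import Literature.AlgebraicGeometry.Resolution.RegularLocalRingsNormal

/-!
# Crux `NonRuledDivisors` (stmt-ResolutionOfSingularities-18075, route `RuledResidues`) —
# the set-builder is SATISFIABLE: one typed member (the cusp), so `Infinite` is the whole content

`NonRuledDivisors` asks for INFINITELY many valuation rings `W` in a five-clause set-builder
(`k ⊆ W`, DVR, essentially of finite type, centred at a NON-REGULAR point of the affine model `R`,
residue field not ruled over `k`).  A refuter must rule out the cheap kill "the set-builder is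
unsatisfiable / always empty".  This file exhibits, sorry-free and definition-free, ONE member in
the smallest possible regime:

* `k = 𝔽₂`, `K = k(X)`, `R = k[X², X³] ⊆ K` (the CUSP, `Frac R = K`), `W = k[X]_(X)` (the unique
  place over the cusp): `W` is a DVR containing `k` and `R`, essentially of finite type (`B = k[X]`),
  its residue field is `k` (so NOT ruled: no transcendental element), and its centre on `R` is the
  cusp, whose local ring is NOT regular — proved resolution-free via Matsumura 19.4 (in tree:
  `isIntegrallyClosed_of_isRegularLocalRing`): were `R_𝔭` regular it would be integrally closed,
  but `X = X³/X²` is integral (`X² ∈ R`) and not in `R_𝔭` (comparing the `X³`-coefficients of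
  `f_r · X² = f_s · X³` forces `f_s(0) = 0`, i.e. `s ∈ 𝔭`).
* `nonRuledDivisors_withNonempty_holds` — the crux with `Set.Infinite` weakened to `Set.Nonempty`
  (everything else verbatim) HOLDS.  Together with `Negative/NoAlgebraicWitness.lean` (trdeg 0
  empty) and `Negative/WithoutSingularCentreHolds.lean` (Sing clause load-bearing) this completes
  the cheap-attack map: every conjunct is satisfiable, jointly, and only INFINITUDE over a
  singular locus — i.e. the failure of NRF, open in `trdeg ≥ 4` — is in question.

This file does NOT refute the crux.
-/

set_option linter.dupNamespace false

namespace Summit.ResolutionOfSingularities.ResolutionOfSingularities.Theorems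

open Polynomial

/-- Elements of the cusp algebra `k[X², X³] ⊆ k(X)` are (images of) polynomials with vanishing
linear coefficient. [folklore] -/
theorem nonRuledDivisorsNeg_cusp_coeff_one (k : Type) [Field k] (r : RatFunc k)
    (hr : r ∈ Algebra.adjoin k ({algebraMap k[X] (RatFunc k) (X ^ 2),
      algebraMap k[X] (RatFunc k) (X ^ 3)} : Set (RatFunc k))) :
    ∃ f : k[X], f.coeff 1 = 0 ∧ algebraMap k[X] (RatFunc k) f = r := by
  induction hr using Algebra.adjoin_induction with
  | mem x hx =>
    rcases hx with rfl | rfl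
    · exact ⟨X ^ 2, by simp [coeff_X_pow], rfl⟩
    · exact ⟨X ^ 3, by simp [coeff_X_pow], rfl⟩
  | algebraMap c =>
    refine ⟨C c, by simp, ?_⟩
    rw [IsScalarTower.algebraMap_apply k k[X] (RatFunc k), Polynomial.algebraMap_eq]
  | add x y _ _ hx hy =>
    obtain ⟨f, hf, rfl⟩ := hx
    obtain ⟨g, hg, rfl⟩ := hy
    exact ⟨f + g, by simp [hf, hg], by simp⟩
  | mul x y _ _ hx hy =>
    obtain ⟨f, hf, rfl⟩ := hx
    obtain ⟨g, hg, rfl⟩ := hy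
    refine ⟨f * g, ?_, by simp⟩
    rw [coeff_mul, Finset.Nat.sum_antidiagonal_succ, Finset.Nat.antidiagonal_zero,
      Finset.sum_singleton]
    simp [hf, hg]

/-- `X² · h ∈ k[X², X³]` for every polynomial `h`. [folklore] -/
theorem nonRuledDivisorsNeg_cusp_X_sq_mul_mem (k : Type) [Field k] (h : k[X]) :
    algebraMap k[X] (RatFunc k) (X ^ 2 * h) ∈ Algebra.adjoin k
      ({algebraMap k[X] (RatFunc k) (X ^ 2), algebraMap k[X] (RatFunc k) (X ^ 3)} :
        Set (RatFunc k)) := by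
  set R := Algebra.adjoin k ({algebraMap k[X] (RatFunc k) (X ^ 2),
    algebraMap k[X] (RatFunc k) (X ^ 3)} : Set (RatFunc k)) with hR
  have h2 : algebraMap k[X] (RatFunc k) (X ^ 2) ∈ R := Algebra.subset_adjoin (by simp)
  have h3 : algebraMap k[X] (RatFunc k) (X ^ 3) ∈ R := Algebra.subset_adjoin (by simp)
  -- all powers `X^(n+2)` lie in `R`
  have hpow : ∀ n : ℕ, algebraMap k[X] (RatFunc k) (X ^ (n + 2)) ∈ R := by
    intro n
    induction n using Nat.strong_induction_on with
    | _ n ih =>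
      match n with
      | 0 => simpa using h2
      | 1 => simpa using h3
      | (m + 2) =>
        have hm := ih m (by omega)
        have : (X : k[X]) ^ (m + 2 + 2) = X ^ (m + 2) * X ^ 2 := by ring
        rw [this, map_mul]
        exact R.mul_mem hm h2
  induction h using Polynomial.induction_on' with
  | add p q hp hq =>
    rw [mul_add, map_add]
    exact R.add_mem hp hq
  | monomial n a =>
    rw [← C_mul_X_pow_eq_monomial]
    have : (X : k[X]) ^ 2 * (C a * X ^ n) = C a * X ^ (n + 2) := by ring
    rw [this, map_mul, ← Polynomial.algebraMap_eq, ← IsScalarTower.algebraMap_apply,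
      ← Algebra.smul_def]
    exact R.smul_mem (hpow n) a

/-- The cusp algebra is finitely generated and `k(X)` is its fraction field (`z = (X²·num z)/(X²·den z)`
with both in `k[X², X³]`). [folklore] -/
theorem nonRuledDivisorsNeg_cusp_isFractionRing (k : Type) [Field k] :
    IsFractionRing (Algebra.adjoin k ({algebraMap k[X] (RatFunc k) (X ^ 2),
      algebraMap k[X] (RatFunc k) (X ^ 3)} : Set (RatFunc k))) (RatFunc k) := by
  set R := Algebra.adjoin k ({algebraMap k[X] (RatFunc k) (X ^ 2),
    algebraMap k[X] (RatFunc k) (X ^ 3)} : Set (RatFunc k)) with hR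
  refine (isLocalization_iff _ _).mpr ⟨?_, ?_, ?_⟩
  · rintro ⟨y, hy⟩
    have hy0 : (y : RatFunc k) ≠ 0 := fun h => nonZeroDivisors.ne_zero hy (Subtype.ext h)
    exact isUnit_iff_ne_zero.mpr hy0
  · intro z
    have hX2 : algebraMap k[X] (RatFunc k) (X ^ 2) ≠ 0 :=
      RatFunc.algebraMap_ne_zero (pow_ne_zero 2 X_ne_zero)
    have hden : algebraMap k[X] (RatFunc k) z.denom ≠ 0 :=
      RatFunc.algebraMap_ne_zero (RatFunc.denom_ne_zero z)
    have hden2 : algebraMap k[X] (RatFunc k) (X ^ 2 * z.denom) ≠ 0 := by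
      rw [map_mul]; exact mul_ne_zero hX2 hden
    refine ⟨(⟨algebraMap k[X] (RatFunc k) (X ^ 2 * z.num), nonRuledDivisorsNeg_cusp_X_sq_mul_mem k _⟩,
      ⟨⟨algebraMap k[X] (RatFunc k) (X ^ 2 * z.denom), nonRuledDivisorsNeg_cusp_X_sq_mul_mem k _⟩,
        mem_nonZeroDivisors_of_ne_zero fun h => hden2 (congrArg Subtype.val h)⟩), ?_⟩
    change z * algebraMap k[X] (RatFunc k) (X ^ 2 * z.denom) = algebraMap k[X] (RatFunc k) (X ^ 2 * z.num)
    have h := RatFunc.num_div_denom z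
    rw [div_eq_iff hden] at h
    rw [map_mul, map_mul, h]
    ring
  · intro x y hxy
    exact ⟨1, by simpa using Subtype.ext hxy⟩

/-- **One member of the crux's witness set over the CUSP** (any field `k`): `K = k(X)`,
`R = k[X², X³]`, `W = k[X]_(X)`.  The non-regularity of the centre is proved via Matsumura 19.4
(`isIntegrallyClosed_of_isRegularLocalRing`, in tree): `X = X³/X²` is integral over `R_𝔭` but not
in it. [folklore] -/
theorem nonRuledDivisorsNeg_cusp_member (k : Type) [Field k] :
    ∃ W : ValuationSubring (RatFunc k), W ∈ {W : ValuationSubring (RatFunc k) | ∃ hk : (∀ c : k, algebraMap k (RatFunc k) c ∈ W), IsDiscreteValuationRing W ∧ (∃ B : Subalgebra k (RatFunc k), B.FG ∧ B.toSubring ≤ W.toSubring ∧ ∀ x : RatFunc k, x ∈ W → ∃ b s : RatFunc k, b ∈ B ∧ s ∈ B ∧ s ∉ W.nonunits ∧ x * s = b) ∧ (∃ h : (Algebra.adjoin k ({algebraMap k[X] (RatFunc k) (X ^ 2), algebraMap k[X] (RatFunc k) (X ^ 3)} : Set (RatFunc k))).toSubring ≤ W.toSubring, ¬ IsRegularLocalRing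 (Localization.AtPrime (Ideal.comap (Subring.inclusion h) (IsLocalRing.maximalIdeal W)))) ∧ ¬ (∃ (L : Subfield (IsLocalRing.ResidueField W)) (t : IsLocalRing.ResidueField W), (∀ c : k, IsLocalRing.residue W ⟨algebraMap k (RatFunc k) c, hk c⟩ ∈ L) ∧ (∀ f : Polynomial L, f ≠ 0 → Polynomial.eval₂ L.subtype t f ≠ 0) ∧ (∀ x : IsLocalRing.ResidueField W, ∃ f g : Polynomial L, Polynomial.eval₂ L.subtype t g ≠ 0 ∧ x * Polynomial.eval₂ L.subtype t g = Polynomial.eval₂ L.subtype t f))} := by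
  classical
  set R : Subalgebra k (RatFunc k) := Algebra.adjoin k ({algebraMap k[X] (RatFunc k) (X ^ 2),
    algebraMap k[X] (RatFunc k) (X ^ 3)} : Set (RatFunc k)) with hRdef
  obtain ⟨W, hpoly, hdvd, hdvr, hfrac, hconst⟩ := nonRuledDivisorsNeg_linearPlace k 0
  have hX : (X : k[X]) - C 0 = X := by rw [map_zero, sub_zero]
  have hk : ∀ c : k, algebraMap k (RatFunc k) c ∈ W := fun c => by
    rw [IsScalarTower.algebraMap_apply k k[X] (RatFunc k)]
    exact hpoly _
  have hRW : R.toSubring ≤ W.toSubring := by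
    intro r hr
    obtain ⟨f, -, hf⟩ := nonRuledDivisorsNeg_cusp_coeff_one k r hr
    rw [← hf]
    exact hpoly f
  refine ⟨W, hk, hdvr, ⟨(IsScalarTower.toAlgHom k k[X] (RatFunc k)).range,
    nonRuledDivisorsNeg_polynomialRange_fg k, ?_, ?_⟩, ⟨hRW, ?_⟩, ?_⟩
  · rintro _ ⟨f, rfl⟩
    exact hpoly f
  · intro x hx
    obtain ⟨n, d, hd, hnd⟩ := hfrac x hx
    exact ⟨algebraMap k[X] _ n, algebraMap k[X] _ d, ⟨n, rfl⟩, ⟨d, rfl⟩,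
      fun h => hd ((hdvd d).mp h), hnd⟩
  · -- the centre (the cusp) is NOT regular
    intro hreg
    set 𝔭 : Ideal R.toSubring :=
      Ideal.comap (Subring.inclusion hRW) (IsLocalRing.maximalIdeal W) with h𝔭
    haveI : IsDomain (Localization.AtPrime 𝔭) :=
      Literature.AlgebraicGeometry.Resolution.isDomain_of_isRegularLocalRing _
    haveI hic : IsIntegrallyClosed (Localization.AtPrime 𝔭) :=
      Literature.AlgebraicGeometry.Resolution.isIntegrallyClosed_of_isRegularLocalRing _
    -- `k(X)` as the fraction field of `R_𝔭`
    have hunit : ∀ s : 𝔭.primeCompl, IsUnit (R.toSubring.subtype s) := by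
      intro s
      apply isUnit_iff_ne_zero.mpr
      intro hs0
      have : (s : R.toSubring) = 0 := Subtype.ext hs0
      exact s.2 (this ▸ 𝔭.zero_mem)
    letI : Algebra (Localization.AtPrime 𝔭) (RatFunc k) := (IsLocalization.lift hunit).toAlgebra
    have halg : ∀ y : Localization.AtPrime 𝔭, algebraMap (Localization.AtPrime 𝔭) (RatFunc k) y =
        IsLocalization.lift hunit y := fun y => rfl
    haveI : IsScalarTower R.toSubring (Localization.AtPrime 𝔭) (RatFunc k) :=
      IsScalarTower.of_algebraMap_eq fun r => by
        rw [halg, IsLocalization.lift_eq]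
        rfl
    haveI : IsFractionRing R.toSubring (RatFunc k) := nonRuledDivisorsNeg_cusp_isFractionRing k
    haveI : IsFractionRing (Localization.AtPrime 𝔭) (RatFunc k) :=
      IsFractionRing.isFractionRing_of_isDomain_of_isLocalization 𝔭.primeCompl
        (Localization.AtPrime 𝔭) (RatFunc k)
    -- `X` is integral over `R_𝔭` (`X² ∈ R`) …
    have h2mem : algebraMap k[X] (RatFunc k) (X ^ 2) ∈ R := Algebra.subset_adjoin (by simp)
    let a2 : R.toSubring := ⟨algebraMap k[X] (RatFunc k) (X ^ 2), h2mem⟩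
    have ha2K : algebraMap (Localization.AtPrime 𝔭) (RatFunc k)
        (algebraMap R.toSubring (Localization.AtPrime 𝔭) a2) = algebraMap k[X] (RatFunc k) (X ^ 2) := by
      rw [← IsScalarTower.algebraMap_apply]
      rfl
    have hint : IsIntegral (Localization.AtPrime 𝔭) (algebraMap k[X] (RatFunc k) X) := by
      refine ⟨X ^ 2 - C (algebraMap R.toSubring (Localization.AtPrime 𝔭) a2),
        monic_X_pow_sub_C _ two_ne_zero, ?_⟩
      simp only [eval₂_sub, eval₂_X_pow, eval₂_C]
      rw [ha2K, ← map_pow, sub_self]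
    -- … hence in `R_𝔭`: `X = r / s` with `s ∉ 𝔭`
    obtain ⟨y, hy⟩ := (isIntegrallyClosed_iff (RatFunc k)).mp hic hint
    obtain ⟨⟨r, s⟩, rfl⟩ := IsLocalization.mk'_surjective 𝔭.primeCompl y
    have hrs : (r : RatFunc k) = (s : R.toSubring) * algebraMap k[X] (RatFunc k) X := by
      have h := IsLocalization.mk'_spec' (Localization.AtPrime 𝔭) r s
      have h' := congrArg (algebraMap (Localization.AtPrime 𝔭) (RatFunc k)) h
      rw [map_mul, hy, ← IsScalarTower.algebraMap_apply, ← IsScalarTower.algebraMap_apply] at h'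
      exact h'.symm
    -- compare linear coefficients of `f_r = f_s · X`
    obtain ⟨fr, hfr1, hfr⟩ := nonRuledDivisorsNeg_cusp_coeff_one k r r.2
    obtain ⟨fs, -, hfs⟩ := nonRuledDivisorsNeg_cusp_coeff_one k s s.1.2
    have hpeq : fr = fs * X := by
      apply IsFractionRing.injective k[X] (RatFunc k)
      rw [map_mul, hfr, hfs]
      exact hrs
    have h0 : fs.coeff 0 = 0 := by
      have h1 := congrArg (fun f : k[X] => f.coeff 1) hpeq
      simp only [hfr1, coeff_mul_X] at h1
      exact h1.symm
    -- but `s ∉ 𝔭`, i.e. `X ∤ f_s`, i.e. `f_s(0) ≠ 0`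
    have hs : (s : R.toSubring) ∉ 𝔭 := s.2
    apply hs
    change Subring.inclusion hRW (s : R.toSubring) ∈ IsLocalRing.maximalIdeal W
    rw [← ValuationSubring.coe_mem_nonunits_iff, Subring.coe_inclusion, ← hfs, hdvd, hX, X_dvd_iff]
    exact h0
  · -- residue field `= k`: not ruled
    rintro ⟨L, t, hLk, htrans, -⟩
    obtain ⟨y, rfl⟩ := IsLocalRing.residue_surjective t
    obtain ⟨c, hc⟩ := hconst y y.2
    have hyc : IsLocalRing.residue W y = IsLocalRing.residue W ⟨algebraMap k (RatFunc k) c, hk c⟩ := by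
      rw [← sub_eq_zero, ← map_sub, IsLocalRing.residue_eq_zero_iff,
        ← ValuationSubring.coe_mem_nonunits_iff]
      simpa using hc
    have ht : IsLocalRing.residue W y ∈ L := hyc ▸ hLk c
    refine htrans (Polynomial.X - Polynomial.C ⟨_, ht⟩) (X_sub_C_ne_zero _) ?_
    simp

/-- **`NonRuledDivisors` WITH `Set.Infinite` WEAKENED TO `Set.Nonempty` HOLDS** (everything else
verbatim): `p = 2`, `k = 𝔽₂`, `K = k(X)`, `R = k[X², X³]` (the cusp), `W = k[X]_(X)`.  So the
crux's set-builder is jointly satisfiable; only INFINITUDE (= failure of NRF) is in question. -/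
theorem nonRuledDivisors_withNonempty_holds :
    ∃ p : ℕ, p.Prime ∧ ∃ (k K : Type) (_ : Field k) (_ : CharP k p) (_ : Field K) (_ : Algebra k K), ∃ R : Subalgebra k K, R.FG ∧ IsFractionRing R K ∧ Set.Nonempty {W : ValuationSubring K | ∃ hk : (∀ c : k, algebraMap k K c ∈ W), IsDiscreteValuationRing W ∧ (∃ B : Subalgebra k K, B.FG ∧ B.toSubring ≤ W.toSubring ∧ ∀ x : K, x ∈ W → ∃ b s : K, b ∈ B ∧ s ∈ B ∧ s ∉ W.nonunits ∧ x * s = b) ∧ (∃ h : R.toSubring ≤ W.toSubring, ¬ IsRegularLocalRing (Localization.AtPrime (Ideal.comap (Subring.inclusion h) (IsLocalRing.maximalIdeal W)))) ∧ ¬ (∃ (L : Subfield (IsLocalRing.ResidueField W)) (t : IsLocalRing.ResidueField W), (∀ c : k, IsLocalRing.residue W ⟨algebraMap k K c, hk c⟩ ∈ L) ∧ (∀ f : Polynomial L, f ≠ 0 → Polynomial.eval₂ L.subtype t f ≠ 0) ∧ (∀ x : IsLocalRing.ResidueField W, ∃ f g : Polynomial L, Polynomial.eval₂ L.subtype t g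 ≠ 0 ∧ x * Polynomial.eval₂ L.subtype t g = Polynomial.eval₂ L.subtype t f))} :=
  ⟨2, Nat.prime_two, ZMod 2, RatFunc (ZMod 2), inferInstance, inferInstance, inferInstance,
    inferInstance, Algebra.adjoin (ZMod 2) ({algebraMap (ZMod 2)[X] (RatFunc (ZMod 2)) (X ^ 2),
      algebraMap (ZMod 2)[X] (RatFunc (ZMod 2)) (X ^ 3)} : Set (RatFunc (ZMod 2))),
    Subalgebra.fg_def.mpr ⟨_, (Set.finite_singleton _).insert _, rfl⟩,
    nonRuledDivisorsNeg_cusp_isFractionRing (ZMod 2), nonRuledDivisorsNeg_cusp_member (ZMod 2)⟩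

end Summit.ResolutionOfSingularities.ResolutionOfSingularities.Theorems
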